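import Literature.AnabelianGeometry.AbsoluteAnabelian.MonoidKummerModelMuZhat
import Literature.AnabelianGeometry.AbsoluteAnabelian.LocalTateModuleH2

/-!
# [AbsTopIII] Prop 3.2 (i) at the model: the `H²`-slot of the model Kummer theory REFILLED with the real
# continuous cohomology `H²(G_k, Ẑ(1))` and the isomorphism `H²(G_k, Ẑ(1)) ⥲ Ẑ` of local class field theory

S. Mochizuki, *Topics in absolute anabelian geometry III*, §3, Prop. 3.2 (i) p. 71 l. 18–60 ("a functorial
algorithm for constructing the natural isomorphism `H²(G, μ_Ẑ(M_TM)) ⥲ Ẑ`" via the Brauer group and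
`G ↠ G^unr ⥲ Ẑ`; bib key `MochizukiAbsTopIII2015`, kurims pages, lit key `paper:url-5493eb38cbb7`) = Cor. 1.10
(i)(a) p. 42 at `μ_Ẑ(M_TM) ⥲ μ_Ẑ(G_k)`.

abc-iut-L4-t2's `MonoidKummerTheory` (`MonoidKummerMaps.lean`) types (i) as the output field
`h2Iso : coh.H2 ≃+ Ẑ`; the model instance `ModelMLFGaloisData.kummerTheory` (`MonoidKummerModel.lean`) left
the `H²`-slot a PLACEHOLDER ("`H2 := Ẑ` itself and `h2Iso := id` — (i) is NOT discharged here"; layer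
registry: «the model's `H²`-slot stays L4-t2's placeholder `Ẑ`/refl»).  The tree now PROVES the needed local
class field theory (abc-iut-L4-t11/L4-t16/L4-d3/w5-d198/w5-d214 lineages, `LocalTateModuleH2.lean`):
`continuousCohomologyTwoTateModuleEquiv K : H²_cont(G_K, Ẑ(1)) ≃+ lim_n H²(G_K, μ_n)` and
`cohomologyLimitMuEquivZHat K : lim_n H²(G_K, μ_n) ≃+ Ẑ` (invariant maps of LCFT, Serre XIII §3 / [AbsAnab]
Prop. 1.2.1 (vii)).  This file REFILLS the slot:

* `MLFClosure.galH2 C` — the REAL `H²_cont(G_k, Ẑ(1))` (Mathlib `continuousCohomology` of the Tate module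
  `Ẑ(1) = lim_n μ_n(k^alg)` of abc-iut's `tateModuleMu`), and **`MLFClosure.galH2EquivZhat C : H²_cont(G_k, Ẑ(1)) ≃+ Ẑ`**
  (the two tree equivalences, then `ULift` into the typed target `ZhatAdd`);
* **`ModelMLFGaloisData.kummerTheoryStd R : MonoidKummerTheory (Π_k ↷ 𝒪_k̄^⊳)`** — the model Kummer theory with
  EVERY output slot a real object: `coh.H1 = H¹(H, Λ(k̄ˣ))` (Kummer classes), `coh.H2 = H²_cont(G_k, Ẑ(1))`,
  `h2Iso =` LCFT, `muG = μ_Ẑ(G_k)` (group-theoretic, `kummerTheoryMuZhat`), `cycIso =` Rmk. 3.2.1, `F = k̄`,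
  `addStr = (𝒪_k̄^⊳ ⊆ k̄)`; `kummerTheoryStd_kummer/_H2/_h2Iso/_muG` (rfl), `_recoversClosure`;
* its transport to abstract MLF-Galois `TM`-pairs `GaloisMonoidPair.ModelPresentation.kummerTheoryStd` and the
  unconditional existence form `exists_monoidKummerTheory_std`.

HONEST SCOPE.  The `H²` here is that of the FIELD-theoretic Tate module `Ẑ(1) = lim_n μ_n` of `k^alg` over
`G_k = Gal(k^alg/k)` (= `H²(G, μ_Ẑ(M_TM))` up to the identifications `μ_Ẑ(M_TM) ⥲ Λ(k̄ˣ) ⥲ Ẑ(1)` of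
Rmk. 3.2.1 / `k̄ ≃ k^alg`, and inflation along `Π_k ↠ G_k`, which print performs at `G`); the
isomorphism with `Ẑ` is the tree's LCFT chain, not re-derived; the printed FUNCTORIALITY of (i) «dividing by
the index» (Rmk. 3.2.2) is abc-iut-w5-d201's row and is not asserted here.  Nothing in this file bears on
[IUTchIII] Cor. 3.12; no side taken.
-/

noncomputable section

namespace Literature.AnabelianGeometry.AbsoluteAnabelian

open Literature.NumberTheory.GaloisRepresentations

section Model

variable (C : MLFClosure.{0}) (D : ModelMLFGaloisData C.k C.K) (R : TorsionReciprocityData C.k)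

namespace MLFClosure

/-- **`H²_cont(G_k, Ẑ(1))`** — Mathlib's continuous cohomology in degree `2` of the absolute Galois group
`G_k = Gal(k^alg/k)` with coefficients the Tate module `Ẑ(1) = lim_n μ_n(k^alg)` (abc-iut `tateModuleMu`), as a
type (REAL object). [cite: MochizukiAbsTopIII2015, Proposition 3.2 (i) p.71] -/
abbrev galH2 : Type := continuousCohomology 2 (tateModuleMu C.k).toTopRep

/-- **Prop 3.2 (i) / Cor 1.10 (i)(a) at the model: `H²_cont(G_k, Ẑ(1)) ⥲ Ẑ`** — the tree's local class field
theory (`continuousCohomologyTwoTateModuleEquiv`: `H²_cont(G_k, Ẑ(1)) ≃ lim_n H²(G_k, μ_n)`, NSW II 2.7.5;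
`cohomologyLimitMuEquivZHat`: `lim_n H²(G_k, μ_n) ≃ Ẑ` by the invariant maps, [AbsAnab] Prop. 1.2.1 (vii)),
landing in the typed target `ZhatAdd = Ẑ` of `MonoidKummerTheory.h2Iso`.
[cite: MochizukiAbsTopIII2015, Proposition 3.2 (i) p.71] -/
def galH2EquivZhat : C.galH2 ≃+ ZhatAdd.{0} :=
  ((continuousCohomologyTwoTateModuleEquiv C.k).trans (cohomologyLimitMuEquivZHat C.k)).trans
    AddEquiv.ulift.symm

end MLFClosure

namespace ModelMLFGaloisData

/-- The cohomology data of the model with the `H²`-slot REFILLED: `H¹(H, Λ(k̄ˣ))` as in `kummerCohomology`,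
`H² := H²_cont(G_k, Ẑ(1))`. [cite: MochizukiAbsTopIII2015, Proposition 3.2 (i) p.71] -/
def kummerCohomologyStd : ContCohomologyData D.tmPair.Pi :=
  { D.kummerCohomology C with
    H2 := C.galH2
    grpH2 := inferInstance }

/-- **The model Kummer theory with every slot real** (`Std`): cohomology `kummerCohomologyStd` (`H²` =
`H²_cont(G_k, Ẑ(1))`), `h2Iso := galH2EquivZhat` (Prop. 3.2 (i), LCFT), `muG := μ_Ẑ(G_k)` and `cycIso :=` Rmk.
3.2.1 (`kummerTheoryMuZhat`), Kummer maps / field / additive structure as in `kummerTheory`.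
[cite: MochizukiAbsTopIII2015, Proposition 3.2 (i) p.71] -/
def kummerTheoryStd : MonoidKummerTheory D.tmPair :=
  { kummerTheoryMuZhat C D R with
    coh := kummerCohomologyStd C D
    h2Iso := C.galH2EquivZhat }

/-- The `H²`-slot is the real `H²_cont(G_k, Ẑ(1))` (definitional). [cite: MochizukiAbsTopIII2015, Proposition 3.2 (i) p.71] -/
theorem kummerTheoryStd_H2 : (kummerTheoryStd C D R).coh.H2 = C.galH2 := rfl

/-- `h2Iso` is the LCFT isomorphism `H²_cont(G_k, Ẑ(1)) ⥲ Ẑ` (definitional). [cite: MochizukiAbsTopIII2015, Proposition 3.2 (i) p.71] -/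
theorem kummerTheoryStd_h2Iso : (kummerTheoryStd C D R).h2Iso = C.galH2EquivZhat := rfl

/-- `muG` is the group-theoretic `μ_Ẑ(G_k)` (definitional). [cite: MochizukiAbsTopIII2015, Remark 3.2.1 p.73] -/
theorem kummerTheoryStd_muG : (kummerTheoryStd C D R).muG = muZhat (Field.absoluteGaloisGroup C.k) := rfl

/-- The Kummer maps are those of `kummerTheory` (definitional). [cite: MochizukiAbsTopIII2015, Proposition 3.2 (ii) p.71] -/
theorem kummerTheoryStd_kummer (H : OpenSubgroup D.tmPair.Pi)
    (m : {m : D.tmPair.M // ∀ h : H, (h : D.tmPair.Pi) • m = m}) :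
    (kummerTheoryStd C D R).kummer H m = (D.kummerTheory C).kummer H m := rfl

/-- The colimit Kummer map is that of `kummerTheory` (definitional). [cite: MochizukiAbsTopIII2015, Proposition 3.2 (ii) p.71] -/
theorem kummerTheoryStd_kummerLim (m : D.tmPair.M) :
    (kummerTheoryStd C D R).kummerLim m = (D.kummerTheory C).kummerLim m := rfl

/-- Prop. 3.2 (v), objects: the field of (iii) recovers `k̄`. [cite: MochizukiAbsTopIII2015, Proposition 3.2 (v) p.72] -/
theorem kummerTheoryStd_recoversClosure :
    (kummerTheoryStd C D R).RecoversClosure C (fun m : D.tmPair.M => (m : C.K)) :=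
  D.kummerTheory_recoversClosure C

end ModelMLFGaloisData

end Model

/-! ### Abstract pairs -/

namespace GaloisMonoidPair.ModelPresentation

variable {P : GaloisMonoidPair.{0}} (π : P.ModelPresentation) (R : TorsionReciprocityData π.C.k)

/-- **The all-slots-real Kummer theory of an abstract MLF-Galois `TM`-pair**: transport of `kummerTheoryStd`
along the presentation (`transport` keeps `H²`, `h2Iso`, `muG`). [cite: MochizukiAbsTopIII2015, Proposition 3.2 (i) p.71] -/
def kummerTheoryStd : MonoidKummerTheory P :=
  (π.D.kummerTheoryStd π.C R).transport π.iso

/-- Its `H²`-slot is `H²_cont(G_k, Ẑ(1))` (definitional). [cite: MochizukiAbsTopIII2015, Proposition 3.2 (i) p.71] -/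
theorem kummerTheoryStd_H2 : (π.kummerTheoryStd R).coh.H2 = π.C.galH2 := rfl

/-- Its `h2Iso` is the LCFT isomorphism (definitional). [cite: MochizukiAbsTopIII2015, Proposition 3.2 (i) p.71] -/
theorem kummerTheoryStd_h2Iso : (π.kummerTheoryStd R).h2Iso = π.C.galH2EquivZhat := rfl

/-- Its `muG` is `μ_Ẑ(G_k)` (definitional). [cite: MochizukiAbsTopIII2015, Remark 3.2.1 p.73] -/
theorem kummerTheoryStd_muG : (π.kummerTheoryStd R).muG = muZhat (Field.absoluteGaloisGroup π.C.k) := rfl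

/-- Its Kummer maps are those of `π.kummerTheory` (definitional). [cite: MochizukiAbsTopIII2015, Proposition 3.2 (ii) p.71] -/
theorem kummerTheoryStd_kummer (H : OpenSubgroup P.Pi) (m : {m : P.M // ∀ h : H, (h : P.Pi) • m = m}) :
    (π.kummerTheoryStd R).kummer H m = π.kummerTheory.kummer H m := rfl

/-- It recovers the closure (Prop. 3.2 (v), objects). [cite: MochizukiAbsTopIII2015, Proposition 3.2 (v) p.72] -/
theorem kummerTheoryStd_recoversClosure :
    (π.kummerTheoryStd R).RecoversClosure π.C (fun m => ((π.iso.isoM.symm m : π.D.tmPair.M) : π.C.K)) :=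
  (π.D.kummerTheoryStd_recoversClosure π.C R).transport π.iso

end GaloisMonoidPair.ModelPresentation

/-- **[AbsTopIII] Prop 3.2 (i)(ii)(iii)(v)-objects, unconditionally, with every slot real**: every MLF-Galois
`TM`-pair `P` carries a Kummer theory `T` recovering the closure whose `H²`-slot is the continuous cohomology
`H²_cont(G_k, Ẑ(1))` of a model presentation with `h2Iso` the isomorphism `⥲ Ẑ` of local class field theory
and whose `μ_Ẑ(G)`-slot is the group-theoretic `μ_Ẑ(G_k)`. [cite: MochizukiAbsTopIII2015, Proposition 3.2 (i) p.71] -/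
theorem exists_monoidKummerTheory_std (P : GaloisMonoidPair.{0}) (hP : IsMLFGaloisMonoidPair .TM P) :
    ∃ (π : P.ModelPresentation) (T : MonoidKummerTheory P),
      T.coh.H2 = π.C.galH2 ∧ T.muG = muZhat (Field.absoluteGaloisGroup π.C.k) ∧
        T.RecoversClosure π.C (fun m => ((π.iso.isoM.symm m : π.D.tmPair.M) : π.C.K)) := by
  obtain ⟨π⟩ := GaloisMonoidPair.ModelPresentation.nonempty_iff.mpr hP
  obtain ⟨R⟩ := nonempty_torsionReciprocityData π.C.k
  exact ⟨π, π.kummerTheoryStd R, rfl, rfl, π.kummerTheoryStd_recoversClosure R⟩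

end Literature.AnabelianGeometry.AbsoluteAnabelian

end
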